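import Summits.QuantumFields.QCD.Theses.SpectralDefectExtinction
import Summits.QuantumFields.QCD.Theorems.ExtinctionBuildsQCD.Negative.ExtinctIntegrable
import Summits.QuantumFields.QCD.Theorems.SpectralDefectExtinctionWindowExtinctionChessboardDeepAsymptotics
import Summits.QuantumFields.QCD.Theorems.SpectralDefectExtinctionAFBookkeeping

/-!
# Stub `stub_deepOfTwoLine` (S3, deep-band extinction from two-line decay) of line
# `corner-decorrelation-deep-hole`
(crux `Summit.QuantumFields.QCD.Theses.SpectralDefectExtinction.WindowExtinction`, item stmt-QuantumFields-18063)

**Bookkeeping stub.**  Given the pointwise Schur count (S1: for every gauge field, every radius `R > 0` and every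
`n ≥ 1`, `#{roots z of charpoly D_W(U,0,1) : |4 − z| ≥ R} · R^{2n} ≤ ‖K_Uⁿ‖_F²`, `K_U = 4·1 − D_W(U,0,1)`) and the
annealed two-line decay at one `N_f ≤ 16` (S2: the `∏_f |det D_W(U, μ_f, 1)|`-weighted Wilson mean of `‖K_Uⁿ‖_F²`
is `≤ C (2S+1)⁴ (4 − c₁/β)^{2n}` for `β ≥ 1`, `2S+1 ≥ C₀√β`, `μ_f ≥ −1`, `1 ≤ n ≤ β³`), every asymptotically
scaling, polynomially capped, branched regularisation empties the deep band `|4 − z| ≥ 4 − c₁/(2β_k)` in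
phase-quenched mean: the weighted expected root count is `≤ ε ((2S+1)/(2L_k+1))⁴` on every torus `S ≥ L_k`,
eventually in `k`.

Proof.
1. *Eventually in `k`* (`β_k → ∞` by `deep_tendsto_beta_atTop`, `C₀ β_k ≤ L_k` by
   `deep_eventually_const_mul_beta_le_L`, the branch hypothesis, the cap, `a_k ≤ 1`, and `AFBookkeeping`):
   `β_k ≥ max(1, c₁)`, `C₀√β_k ≤ C₀β_k ≤ L_k ≤ S ≤ 2S+1`, `μ_f = m_crit(k) + a_k m_f/Z_m(k) ≥ −1`.
2. *Per torus*: with `R = 4 − c₁/(2β_k) > 0` and `n = ⌊β_k³⌋`, S1 pointwise times the weight, integrated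
   (`integral_mono_of_nonneg`; the Frobenius functional is continuous, hence bounded on the compact configuration
   space, so `frob · weight` is integrable by `integrable_mul_weight`), divided by `∫ weight` (junk `x/0 = 0`
   otherwise) and compared with S2:
   `ratio(count) ≤ C (2S+1)⁴ ((4 − c₁/β_k)/(4 − c₁/(2β_k)))^{2n} ≤ C (2S+1)⁴ e^{c₁/4} e^{−c₁β_k²/4}`
   (`(4 − 2x)/(4 − x) ≤ 1 − x/4 ≤ e^{−x/4}`, `x = c₁/(2β_k)`, `n ≥ β_k³ − 1`).
3. *Asymptotics* (`deepOfTwoLine_eventually_decay`, pure real analysis): `2L_k+1 ≤ 3a_k^{−p}`, so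
   `(2L_k+1)⁴ ≤ 81 e^{p log a_k⁻⁴} ≤ 81 e^{p(Aβ_k + C')}` with `A = 1/b₀ + |2b₁/b₀²|` (AF bookkeeping,
   `0 ≤ log β ≤ β`), and `81 C e^{pC' + c₁/4} e^{β_k(pA − c₁β_k/4)} → 0`; hence
   `C (2L_k+1)⁴ e^{c₁/4} e^{−c₁β_k²/4} ≤ ε` eventually, which is the claim after
   `(2S+1)⁴ = (2L_k+1)⁴ ((2S+1)/(2L_k+1))⁴`.
-/

noncomputable section

namespace Summit.QuantumFields.QCD.Cruxes.WindowExtinction.CornerDecorrelationDeepHole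

open scoped BigOperators Topology Classical
open Filter MeasureTheory
open Literature.MathematicalPhysics.QuantumLattice Literature.MathematicalPhysics.QuantumFieldTheory
  Literature.Probability.LatticeModels
open Summit.QuantumFields.QCD.Theses.SpectralDefectExtinction
open Summit.QuantumFields.QCD.Theorems.ExtinctionBuildsQCD.Negative
  (integrable_mul_weight integrable_natCount_mul_weight countP_roots_charpoly_le_card)
open Summit.QuantumFields.QCD.Cruxes.TipPricing.HermitianFlowCoarea
  (countMeas_measurable_countP stub_countMeasurable)
open Summit.QuantumFields.QCD.Cruxes.WindowExtinction.ChessboardColdCells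
  (deep_tendsto_beta_atTop deep_eventually_const_mul_beta_le_L)
open Summit.QuantumFields.QCD.Theorems (aFBookkeeping_proof betaCoeff₀_pos_of_le_sixteen)

/-! ## §1  Elementary real analysis -/

/-- The one-step contraction of the deep band: for `0 < c₁ ≤ β`, `1 ≤ β`,
`0 ≤ (4 − c₁/β)/(4 − c₁/(2β)) ≤ e^{−c₁/(8β)}` (`(4 − 2x)/(4 − x) ≤ 1 − x/4 ≤ e^{−x/4}`, `x = c₁/(2β)`). -/
theorem deepOfTwoLine_ratio_nonneg_le_exp {c₁ β : ℝ} (hc₁ : 0 < c₁) (hβ1 : 1 ≤ β) (hβc : c₁ ≤ β) :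
    0 ≤ (4 - c₁ / β) / (4 - c₁ / (2 * β)) ∧
      (4 - c₁ / β) / (4 - c₁ / (2 * β)) ≤ Real.exp (-(c₁ / (8 * β))) := by
  have hβ : 0 < β := by linarith
  obtain ⟨x, hx⟩ : ∃ x : ℝ, x = c₁ / (2 * β) := ⟨_, rfl⟩
  have hx0 : 0 < x := by rw [hx]; positivity
  have hx1 : x ≤ 1 / 2 := by
    rw [hx, div_le_iff₀ (by positivity)]
    linarith
  have e1 : c₁ / β = 2 * x := by rw [hx]; ring
  have e2 : c₁ / (2 * β) = x := hx.symm
  have e3 : c₁ / (8 * β) = x / 4 := by rw [hx]; ring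
  rw [e1, e2, e3]
  have hden : 0 < 4 - x := by linarith
  refine ⟨div_nonneg (by linarith) hden.le, ?_⟩
  rw [div_le_iff₀ hden]
  have h3 : 1 - x / 4 ≤ Real.exp (-(x / 4)) := by
    have := Real.add_one_le_exp (-(x / 4))
    linarith
  have h4 : 4 - 2 * x ≤ (1 - x / 4) * (4 - x) := by nlinarith [sq_nonneg x]
  exact h4.trans (mul_le_mul_of_nonneg_right h3 hden.le)

/-- Chebyshev at `n = ⌊β³⌋`: the deep-band ratio raised to the power `2n`, `n ≥ β³ − 1`, is
`≤ e^{c₁/4} e^{−c₁β²/4}`. -/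
theorem deepOfTwoLine_pow_le_exp {c₁ β : ℝ} (hc₁ : 0 < c₁) (hβ1 : 1 ≤ β) (hβc : c₁ ≤ β) {n : ℕ}
    (hn : β ^ 3 - 1 ≤ n) :
    ((4 - c₁ / β) / (4 - c₁ / (2 * β))) ^ (2 * n) ≤
      Real.exp (c₁ / 4) * Real.exp (-(c₁ * β ^ 2 / 4)) := by
  have hβ : 0 < β := by linarith
  obtain ⟨hq0, hq1⟩ := deepOfTwoLine_ratio_nonneg_le_exp hc₁ hβ1 hβc
  calc ((4 - c₁ / β) / (4 - c₁ / (2 * β))) ^ (2 * n)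
      ≤ Real.exp (-(c₁ / (8 * β))) ^ (2 * n) := pow_le_pow_left₀ hq0 hq1 _
    _ = Real.exp ((2 * n : ℕ) * (-(c₁ / (8 * β)))) := (Real.exp_nat_mul _ _).symm
    _ ≤ Real.exp (c₁ / 4 + -(c₁ * β ^ 2 / 4)) := by
        rw [Real.exp_le_exp]
        have key : c₁ * (β ^ 3 - β) ≤ c₁ * n := mul_le_mul_of_nonneg_left (by linarith) hc₁.le
        have h4β : (0 : ℝ) < 4 * β := by positivity
        have e1 : ((2 * n : ℕ) : ℝ) * (-(c₁ / (8 * β))) = -(c₁ * n) / (4 * β) := by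
          push_cast
          ring
        rw [e1, div_le_iff₀ h4β]
        have e2 : (c₁ / 4 + -(c₁ * β ^ 2 / 4)) * (4 * β) = c₁ * β - c₁ * β ^ 3 := by ring
        rw [e2]
        linarith
    _ = Real.exp (c₁ / 4) * Real.exp (-(c₁ * β ^ 2 / 4)) := Real.exp_add _ _

/-- **The AF entropy loses against the Gaussian factor** (pure real analysis).  If `a_k → 0⁺`, `β_k → +∞`,
`L_k ≤ a_k^{−p}` and `|log a_k⁻⁴ − β_k/b₀ + (2b₁/b₀²) log β_k| ≤ C'` eventually (`b₀ > 0`), then for all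
`C, c₁, ε > 0`, eventually `C (2L_k+1)⁴ e^{c₁/4} e^{−c₁β_k²/4} ≤ ε`: indeed `(2L_k+1)⁴ ≤ 81 e^{p(Aβ_k + C')}` with
`A = 1/b₀ + |2b₁/b₀²|`, and `β_k (pA − c₁β_k/4) → −∞`. -/
theorem deepOfTwoLine_eventually_decay {a β : ℕ → ℝ} {L : ℕ → ℕ} {b₀ b₁ C' C c₁ ε : ℝ} {p : ℕ}
    (ha : ∀ k, 0 < a k) (ha0 : Tendsto a atTop (𝓝 0)) (hβ : Tendsto β atTop atTop)
    (hb₀ : 0 < b₀) (hC : 0 < C) (hc₁ : 0 < c₁) (hε : 0 < ε)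
    (hcap : ∀ᶠ k in atTop, (L k : ℝ) ≤ (a k)⁻¹ ^ p)
    (hAF : ∀ᶠ k in atTop,
      |Real.log ((a k)⁻¹ ^ 4) - β k / b₀ + (2 * b₁ / b₀ ^ 2) * Real.log (β k)| ≤ C') :
    ∀ᶠ k in atTop,
      C * (2 * (L k : ℝ) + 1) ^ 4 * (Real.exp (c₁ / 4) * Real.exp (-(c₁ * β k ^ 2 / 4))) ≤ ε := by
  -- the slope of the entropy in `β`, and the constant in front of the Gaussian
  obtain ⟨A, hA_def⟩ : ∃ A : ℝ, A = 1 / b₀ + |2 * b₁ / b₀ ^ 2| := ⟨_, rfl⟩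
  have hA : 0 ≤ A := by rw [hA_def]; positivity
  obtain ⟨D, hD_def⟩ : ∃ D : ℝ, D = 81 * C * Real.exp (p * C' + c₁ / 4) := ⟨_, rfl⟩
  -- `D · exp(β_k (pA − c₁β_k/4)) → 0`
  have hquad : Tendsto (fun k => β k * (p * A - c₁ / 4 * β k)) atTop atBot := by
    refine hβ.atTop_mul_atBot₀ ?_
    have h1 : Tendsto (fun k => -(c₁ / 4) * β k) atTop atBot :=
      hβ.const_mul_atTop_of_neg (by linarith)
    have h2 : Tendsto (fun k => (p : ℝ) * A + -(c₁ / 4) * β k) atTop atBot :=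
      tendsto_atBot_add_const_left _ _ h1
    refine Tendsto.congr (fun k => ?_) h2
    ring
  have hlim : Tendsto (fun k => D * Real.exp (β k * (p * A - c₁ / 4 * β k))) atTop (𝓝 0) := by
    simpa only [mul_zero, Function.comp_def] using (Real.tendsto_exp_atBot.comp hquad).const_mul D
  have hev : ∀ᶠ k in atTop, D * Real.exp (β k * (p * A - c₁ / 4 * β k)) ≤ ε :=
    hlim.eventually_le_const hε
  have ha1 : ∀ᶠ k in atTop, a k ≤ 1 := ha0.eventually_le_const one_pos
  filter_upwards [hev, ha1, hcap, hAF, hβ.eventually_ge_atTop 1] with k hk ha1k hLk hAFk hβk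
  -- Step 1: `log a_k⁻⁴ ≤ A β_k + C'`
  have hlog : Real.log ((a k)⁻¹ ^ 4) ≤ A * β k + C' := by
    have h1 := (abs_le.1 hAFk).2
    have hlb : 0 ≤ Real.log (β k) := Real.log_nonneg hβk
    have hlb' : Real.log (β k) ≤ β k := (Real.log_le_sub_one_of_pos (by linarith)).trans (by linarith)
    have h2 : -(2 * b₁ / b₀ ^ 2 * Real.log (β k)) ≤ |2 * b₁ / b₀ ^ 2| * β k :=
      calc -(2 * b₁ / b₀ ^ 2 * Real.log (β k)) ≤ |2 * b₁ / b₀ ^ 2 * Real.log (β k)| := neg_le_abs _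
        _ = |2 * b₁ / b₀ ^ 2| * Real.log (β k) := by rw [abs_mul, abs_of_nonneg hlb]
        _ ≤ |2 * b₁ / b₀ ^ 2| * β k := mul_le_mul_of_nonneg_left hlb' (abs_nonneg _)
    have h3 : A * β k = β k / b₀ + |2 * b₁ / b₀ ^ 2| * β k := by rw [hA_def]; ring
    linarith
  -- Step 2: `(2L_k+1)⁴ ≤ 81 e^{p(Aβ_k + C')}`
  have hainv : 1 ≤ (a k)⁻¹ := (one_le_inv₀ (ha k)).2 ha1k
  have hP : (1 : ℝ) ≤ (a k)⁻¹ ^ p := one_le_pow₀ hainv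
  have hpos4 : 0 < (a k)⁻¹ ^ 4 := by positivity
  have hL81 : (2 * (L k : ℝ) + 1) ^ 4 ≤ 81 * Real.exp (p * (A * β k + C')) := by
    have h1 : 2 * (L k : ℝ) + 1 ≤ 3 * (a k)⁻¹ ^ p := by linarith
    have h2 : (2 * (L k : ℝ) + 1) ^ 4 ≤ (3 * (a k)⁻¹ ^ p) ^ 4 := pow_le_pow_left₀ (by positivity) h1 4
    have h3 : (3 * (a k)⁻¹ ^ p) ^ 4 = 81 * Real.exp (p * Real.log ((a k)⁻¹ ^ 4)) := by
      rw [Real.exp_nat_mul, Real.exp_log hpos4]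
      ring
    have h4 : Real.exp (p * Real.log ((a k)⁻¹ ^ 4)) ≤ Real.exp (p * (A * β k + C')) :=
      Real.exp_le_exp.2 (mul_le_mul_of_nonneg_left hlog (Nat.cast_nonneg p))
    calc (2 * (L k : ℝ) + 1) ^ 4 ≤ (3 * (a k)⁻¹ ^ p) ^ 4 := h2
      _ = 81 * Real.exp (p * Real.log ((a k)⁻¹ ^ 4)) := h3
      _ ≤ 81 * Real.exp (p * (A * β k + C')) := by linarith
  -- Step 3: assemble
  have hE0 : 0 ≤ Real.exp (c₁ / 4) * Real.exp (-(c₁ * β k ^ 2 / 4)) := by positivity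
  have e : Real.exp (p * (A * β k + C')) * (Real.exp (c₁ / 4) * Real.exp (-(c₁ * β k ^ 2 / 4))) =
      Real.exp (p * C' + c₁ / 4) * Real.exp (β k * (p * A - c₁ / 4 * β k)) := by
    simp only [← Real.exp_add]
    congr 1
    ring
  calc C * (2 * (L k : ℝ) + 1) ^ 4 * (Real.exp (c₁ / 4) * Real.exp (-(c₁ * β k ^ 2 / 4)))
      ≤ C * (81 * Real.exp (p * (A * β k + C'))) * (Real.exp (c₁ / 4) * Real.exp (-(c₁ * β k ^ 2 / 4))) :=
        mul_le_mul_of_nonneg_right (mul_le_mul_of_nonneg_left hL81 hC.le) hE0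
    _ = 81 * C * (Real.exp (p * (A * β k + C')) *
          (Real.exp (c₁ / 4) * Real.exp (-(c₁ * β k ^ 2 / 4)))) := by ring
    _ = D * Real.exp (β k * (p * A - c₁ / 4 * β k)) := by rw [e, hD_def]; ring
    _ ≤ ε := hk

/-! ## §2  The Frobenius functional and the ratio bookkeeping -/

/-- The squared Frobenius norm of the `n`-th power of the hopping matrix `K_U = 4·1 − D_W(U,0,1)` depends
continuously on the gauge field. -/
theorem deepOfTwoLine_continuous_frob (L : ℕ) [NeZero L] (n : ℕ) :
    Continuous fun U : GaugeConfig 4 L SU3 =>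
      ∑ i, ∑ j, ‖(((4 : ℂ) • (1 : Matrix (QuarkIdx L) (QuarkIdx L) ℂ) -
        wilsonDirac (fundamentalRep (Fin 3)) U 0 1) ^ n) i j‖ ^ 2 := by
  have hA : Continuous fun U : GaugeConfig 4 L SU3 =>
      ((4 : ℂ) • (1 : Matrix (QuarkIdx L) (QuarkIdx L) ℂ) - wilsonDirac (fundamentalRep (Fin 3)) U 0 1) ^ n :=
    (continuous_const.sub (continuous_wilsonDirac _ (continuous_fundamentalRep (Fin 3)) 0 1)).pow n
  exact continuous_finsetSum _ fun i _ => continuous_finsetSum _ fun j _ =>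
    ((hA.matrix_elem i j).norm).pow 2

/-- A uniform bound for the squared Frobenius norm of `K_Uⁿ` over the (compact) configuration space. -/
theorem deepOfTwoLine_exists_abs_frob_le (L : ℕ) [NeZero L] (n : ℕ) :
    ∃ B : ℝ, ∀ U : GaugeConfig 4 L SU3,
      |∑ i, ∑ j, ‖(((4 : ℂ) • (1 : Matrix (QuarkIdx L) (QuarkIdx L) ℂ) -
        wilsonDirac (fundamentalRep (Fin 3)) U 0 1) ^ n) i j‖ ^ 2| ≤ B := by
  obtain ⟨U₀, -, hU₀⟩ := (isCompact_univ (X := GaugeConfig 4 L SU3)).exists_isMaxOn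
    Set.univ_nonempty (deepOfTwoLine_continuous_frob L n).continuousOn
  exact ⟨_, fun U => (abs_of_nonneg (by positivity)).trans_le (hU₀ (Set.mem_univ U))⟩

/-- **Ratio bookkeeping** (abstract measure theory).  If `0 ≤ cnt`, `0 ≤ w`, `cnt · R^{2n} ≤ frob` pointwise
(`R > 0`), `frob · w` is integrable, the `w`-ratio of `frob` is `≤ C V⁴ ρ^{2n}` (`C ≥ 0`), `(ρ/R)^{2n} ≤ E` and
`C W⁴ E ≤ ε` (`W > 0`, `ε ≥ 0`), then the `w`-ratio of `cnt` is `≤ ε (V/W)⁴` (junk `x/0 = 0` included). -/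
theorem deepOfTwoLine_ratio_bound {X : Type*} [MeasurableSpace X] (μ : Measure X)
    {cnt frob w : X → ℝ} {R ρ C V W E ε : ℝ} {n : ℕ}
    (hw : ∀ x, 0 ≤ w x) (hcnt : ∀ x, 0 ≤ cnt x) (hR : 0 < R)
    (hpt : ∀ x, cnt x * R ^ (2 * n) ≤ frob x)
    (hfi : Integrable (fun x => frob x * w x) μ)
    (hfrob : (∫ x, frob x * w x ∂μ) / (∫ x, w x ∂μ) ≤ C * V ^ 4 * ρ ^ (2 * n))
    (hC : 0 ≤ C) (hW : 0 < W) (hE : (ρ / R) ^ (2 * n) ≤ E) (hdec : C * W ^ 4 * E ≤ ε) (hε : 0 ≤ ε) :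
    (∫ x, cnt x * w x ∂μ) / (∫ x, w x ∂μ) ≤ ε * (V / W) ^ 4 := by
  have hZ0 : 0 ≤ ∫ x, w x ∂μ := integral_nonneg hw
  rcases hZ0.eq_or_lt with hZ | hZ
  · rw [← hZ, div_zero]
    positivity
  · have hR2 : 0 < R ^ (2 * n) := pow_pos hR _
    have h1 : (∫ x, cnt x * w x ∂μ) * R ^ (2 * n) ≤ ∫ x, frob x * w x ∂μ := by
      rw [← integral_mul_const]
      refine integral_mono_of_nonneg (Eventually.of_forall fun x => ?_) hfi
        (Eventually.of_forall fun x => ?_)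
      · exact mul_nonneg (mul_nonneg (hcnt x) (hw x)) hR2.le
      · calc cnt x * w x * R ^ (2 * n) = cnt x * R ^ (2 * n) * w x := by ring
          _ ≤ frob x * w x := mul_le_mul_of_nonneg_right (hpt x) (hw x)
    have h2 : ∫ x, frob x * w x ∂μ ≤ C * V ^ 4 * ρ ^ (2 * n) * ∫ x, w x ∂μ := (div_le_iff₀ hZ).1 hfrob
    have hρR : (ρ / R) ^ (2 * n) * R ^ (2 * n) = ρ ^ (2 * n) := by
      rw [div_pow, div_mul_cancel₀ _ hR2.ne']
    have h3 : ∫ x, cnt x * w x ∂μ ≤ C * V ^ 4 * (ρ / R) ^ (2 * n) * ∫ x, w x ∂μ := by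
      refine le_of_mul_le_mul_right ?_ hR2
      calc (∫ x, cnt x * w x ∂μ) * R ^ (2 * n) ≤ ∫ x, frob x * w x ∂μ := h1
        _ ≤ C * V ^ 4 * ρ ^ (2 * n) * ∫ x, w x ∂μ := h2
        _ = C * V ^ 4 * ((ρ / R) ^ (2 * n) * R ^ (2 * n)) * ∫ x, w x ∂μ := by rw [hρR]
        _ = C * V ^ 4 * (ρ / R) ^ (2 * n) * (∫ x, w x ∂μ) * R ^ (2 * n) := by ring
    have hV : 0 ≤ V ^ 4 := by positivity
    have hVW : V ^ 4 = (V / W) ^ 4 * W ^ 4 := by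
      rw [div_pow, div_mul_cancel₀ _ (pow_ne_zero 4 hW.ne')]
    rw [div_le_iff₀ hZ]
    calc ∫ x, cnt x * w x ∂μ ≤ C * V ^ 4 * (ρ / R) ^ (2 * n) * ∫ x, w x ∂μ := h3
      _ ≤ C * V ^ 4 * E * ∫ x, w x ∂μ :=
          mul_le_mul_of_nonneg_right (mul_le_mul_of_nonneg_left hE (mul_nonneg hC hV)) hZ.le
      _ = (V / W) ^ 4 * (C * W ^ 4 * E) * ∫ x, w x ∂μ := by rw [hVW]; ring
      _ ≤ (V / W) ^ 4 * ε * ∫ x, w x ∂μ :=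
          mul_le_mul_of_nonneg_right (mul_le_mul_of_nonneg_left hdec (by positivity)) hZ.le
      _ = ε * (V / W) ^ 4 * ∫ x, w x ∂μ := by ring

/-! ## §3  The stub -/

/-- **S3 · Deep-band extinction from two-line decay** (registered stub `stub_deepOfTwoLine` of line
`corner-decorrelation-deep-hole`).  Given S1 (pointwise Schur count) and the conclusion of S2 (annealed two-line
decay) at one `N_f ≤ 16` with constants `c₁, C, C₀`, every asymptotically scaling, polynomially capped, branched
regularisation `reg` empties the deep band in phase-quenched mean: for every mass tuple `m > M₀ ≥ 0` and `ε > 0`,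
eventually in `k`, on every odd torus `2S+1 ≥ 2L_k+1`, the `∏_f |det D_W(U, m_f(k), 1)|`-weighted expected number
of characteristic roots `z` of `D_W(U,0,1)` with `|4 − z| ≥ 4 − c₁/(2β_k)` is `≤ ε ((2S+1)/(2L_k+1))⁴`. -/
theorem stub_deepOfTwoLine :
    (∀ (L : ℕ) [NeZero L] (U : GaugeConfig 4 L ↥(Matrix.specialUnitaryGroup (Fin 3) ℂ)) (R : ℝ), 0 < R → ∀ n : ℕ, 1 ≤ n → (Multiset.countP (fun z : ℂ => R ≤ ‖(4 : ℂ) - z‖) (wilsonDirac (fundamentalRep (Fin 3)) U 0 1).charpoly.roots : ℝ) * R ^ (2 * n) ≤ (∑ i, ∑ j, ‖(((4 : ℂ) • (1 : Matrix (QuarkIdx L) (QuarkIdx L) ℂ) - wilsonDirac (fundamentalRep (Fin 3)) U 0 1) ^ n) i j‖ ^ 2)) → ∀ Nf : ℕ, Nf ≤ 16 → ∀ (reg : QCDRegularisation Nf) (c₁ C C₀ M₀ : ℝ), 0 < c₁ → 0 < C → 0 < C₀ → 0 ≤ M₀ → (reg.scheme 0 0 0).HasAsymptoticScaling → (∃ p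 : ℕ, ∀ᶠ k : ℕ in Filter.atTop, (reg.L k : ℝ) ≤ (reg.a k)⁻¹ ^ p) → (∀ᶠ k : ℕ in Filter.atTop, -1 < reg.mcrit k) → (∀ β : ℝ, 1 ≤ β → ∀ S : ℕ, C₀ * Real.sqrt β ≤ 2 * S + 1 → ∀ μ : Fin Nf → ℝ, (∀ f, -1 ≤ μ f) → ∀ n : ℕ, 1 ≤ n → (n : ℝ) ≤ β ^ 3 → (∫ U, (∑ i, ∑ j, ‖(((4 : ℂ) • (1 : Matrix (QuarkIdx (2 * S + 1)) (QuarkIdx (2 * S + 1)) ℂ) - wilsonDirac (fundamentalRep (Fin 3)) U 0 1) ^ n) i j‖ ^ 2) * ∏ f : Fin Nf, ‖fermionDet (wilsonDirac (fundamentalRep (Fin 3)) U (μ f) 1)‖ ∂(wilsonMeasure (d := 4) (L := 2 * S + 1) (fundamentalRep (Fin 3)) β)) / (∫ U, ∏ f : Fin Nf, ‖fermionDet (wilsonDirac (fundamentalRep (Fin 3)) U (μ f) 1)‖ ∂(wilsonMeasure (d := 4) (L := 2 * S + 1) (fundamentalRep (Fin 3)) β)) ≤ C * (2 * S + 1 :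 ℝ) ^ 4 * (4 - c₁ / β) ^ (2 * n)) → ∀ m : Fin Nf → ℝ, (∀ f, M₀ < m f) → ∀ ε : ℝ, 0 < ε → ∀ᶠ k : ℕ in Filter.atTop, ∀ S : ℕ, reg.L k ≤ S → (∫ U, (Multiset.countP (fun z : ℂ => 4 - c₁ / (2 * reg.β k) ≤ ‖(4 : ℂ) - z‖) (wilsonDirac (fundamentalRep (Fin 3)) U 0 1).charpoly.roots : ℝ) * ∏ f : Fin Nf, ‖fermionDet (wilsonDirac (fundamentalRep (Fin 3)) U (reg.mcrit k + reg.a k * m f / reg.Zm k) 1)‖ ∂(wilsonMeasure (d := 4) (L := 2 * S + 1) (fundamentalRep (Fin 3)) (reg.β k))) / (∫ U, ∏ f : Fin Nf, ‖fermionDet (wilsonDirac (fundamentalRep (Fin 3)) U (reg.mcrit k + reg.a k * m f / reg.Zm k) 1)‖ ∂(wilsonMeasure (d := 4) (L := 2 * S + 1) (fundamentalRep (Fin 3)) (reg.β k))) ≤ ε * ((2 * S + 1 : ℝ) / (2 * reg.L k + 1)) ^ 4 := by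
  intro h₁ Nf hNf reg c₁ C C₀ M₀ hc₁ hC hC₀ hM₀ hAS hcap hbr h₂ m hm ε hε
  obtain ⟨p, hp⟩ := hcap
  -- asymptotics of the scheme `reg.scheme 0 0 0` (its `a`, `β`, `L` are `reg.a`, `reg.β`, `reg.L` by `rfl`)
  have hβtop : Tendsto reg.β atTop atTop := deep_tendsto_beta_atTop hNf (reg.scheme 0 0 0) hAS
  have hLβ : ∀ᶠ k in atTop, C₀ * reg.β k ≤ reg.L k := deep_eventually_const_mul_beta_le_L reg hAS hC₀
  obtain ⟨C', hC'⟩ := aFBookkeeping_proof Nf hNf (reg.scheme 0 0 0) hAS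
  have hAF : ∀ᶠ k : ℕ in atTop, |Real.log ((reg.a k)⁻¹ ^ 4) - reg.β k / betaCoeff₀ Nf +
      (2 * betaCoeff₁ Nf / betaCoeff₀ Nf ^ 2) * Real.log (reg.β k)| ≤ C' := hC'
  have hdec := deepOfTwoLine_eventually_decay reg.a_pos reg.tendsto_a hβtop
    (betaCoeff₀_pos_of_le_sixteen hNf) hC hc₁ hε hp hAF
  filter_upwards [hdec, hLβ, hbr, hβtop.eventually_ge_atTop 1, hβtop.eventually_ge_atTop c₁]
    with k hdeck hLk hbrk hβ1 hβc S hS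
  have hβpos : 0 < reg.β k := by linarith
  -- the radius `R = 4 − c₁/(2β_k) > 0`
  have hR : 0 < 4 - c₁ / (2 * reg.β k) := by
    have : c₁ / (2 * reg.β k) ≤ 1 / 2 := by
      rw [div_le_iff₀ (by positivity)]
      linarith
    linarith
  -- the path length `n = ⌊β_k³⌋`
  have hβ3 : (1 : ℝ) ≤ reg.β k ^ 3 := one_le_pow₀ hβ1
  obtain ⟨n, hn1, hnle, hnge⟩ :
      ∃ n : ℕ, 1 ≤ n ∧ (n : ℝ) ≤ reg.β k ^ 3 ∧ reg.β k ^ 3 - 1 ≤ n :=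
    ⟨⌊reg.β k ^ 3⌋₊, Nat.le_floor (by exact_mod_cast hβ3), Nat.floor_le (by positivity),
      by linarith [Nat.lt_floor_add_one (reg.β k ^ 3)]⟩
  -- the bare masses are `≥ −1` on the physical branch
  have hμ : ∀ f, -1 ≤ reg.mcrit k + reg.a k * m f / reg.Zm k := fun f => by
    have h1 : 0 ≤ reg.a k * m f / reg.Zm k :=
      div_nonneg (mul_nonneg (reg.a_pos k).le (hM₀.trans (hm f).le)) (reg.Zm_pos k).le
    linarith
  -- the torus is large enough: `C₀ √β_k ≤ C₀ β_k ≤ L_k ≤ S ≤ 2S+1`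
  have hside : C₀ * Real.sqrt (reg.β k) ≤ 2 * (S : ℝ) + 1 := by
    have h1 : Real.sqrt (reg.β k) ≤ reg.β k :=
      (Real.sqrt_le_left hβpos.le).2 (le_self_pow₀ hβ1 two_ne_zero)
    have h2 : (reg.L k : ℝ) ≤ S := by exact_mod_cast hS
    have h3 : (0 : ℝ) ≤ S := Nat.cast_nonneg S
    calc C₀ * Real.sqrt (reg.β k) ≤ C₀ * reg.β k := mul_le_mul_of_nonneg_left h1 hC₀.le
      _ ≤ reg.L k := hLk
      _ ≤ S := h2
      _ ≤ 2 * (S : ℝ) + 1 := by linarith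
  -- S1 pointwise on the torus of side `2S+1`, S2 in the tilted mean
  have hpt := fun U : GaugeConfig 4 (2 * S + 1) SU3 =>
    h₁ (2 * S + 1) U (4 - c₁ / (2 * reg.β k)) hR n hn1
  have hmean := h₂ (reg.β k) hβ1 S hside (fun f => reg.mcrit k + reg.a k * m f / reg.Zm k) hμ n hn1 hnle
  -- integrability of `frob · weight`
  obtain ⟨B, hB⟩ := deepOfTwoLine_exists_abs_frob_le (2 * S + 1) n
  have hfi := integrable_mul_weight (L := 2 * S + 1) (fun f => reg.mcrit k + reg.a k * m f / reg.Zm k)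
    (reg.β k) (deepOfTwoLine_continuous_frob (2 * S + 1) n).measurable hB
  -- bookkeeping
  refine deepOfTwoLine_ratio_bound _ (fun U => ?_) (fun U => ?_) hR hpt hfi hmean hC.le (by positivity)
    (deepOfTwoLine_pow_le_exp hc₁ hβ1 hβc hnge) hdeck hε.le
  · exact Finset.prod_nonneg fun f _ => norm_nonneg _
  · exact Nat.cast_nonneg _

end Summit.QuantumFields.QCD.Cruxes.WindowExtinction.CornerDecorrelationDeepHole

end
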